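import Literature.NumberTheory.GaloisRepresentations.CyclotomicLevels
import Literature.NumberTheory.GaloisRepresentations.CyclotomicCharacterSurjectiveProofs
import Literature.NumberTheory.GaloisRepresentations.ArtinLFunctionDirichletProofs
import HarnessLib

/-!
# Generators `σ_ℓ` of the cyclotomic levels over `ℚ` (the `σ_ℓ`-choice instance for the
# Kolyvagin derivative; cell `b2b-bsdres`, team n1011, row T-DER support — T-DER-INST)

HONEST FRAMING (cell `b2b-bsdres`, run/shared/lean/b2b/bsd-rank1-residual/, verbatim in every
file): the goal of the cell is to DELETE the COMBINATION-SHAPED residual classes of the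
Birch–Swinnerton-Dyer formula for ALL analytic-rank `≤ 1` elliptic curves over `ℚ` — "full BSD
formula for every rank `≤ 1` curve in class `C`" assembled STRICTLY from published theorems — so
that the rank-`≤ 1` remainder becomes exactly the CONSTRUCTION-SHAPED classes, which are TYPED
(missing-input `Prop`s), NOT attempted. This is not "finishing BSD". Team n1011 (N10/N11, the
additive block `X4 ∧ p = 3`): research route on the CONSTRUCTION-SHAPED class X4 / §I N11; TOOL
theorems of Galois theory only (p-free, curve-free); nothing is booked; no mark / label / flag
text moves; census −0.

## What

Row T-DER (n1011-p11, `cells/n1011/skel/T-DER.md`: the Kolyvagin derivative over the tree's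
`IsEulerSystem`) takes as VISIBLE hypotheses a choice, for every usable prime `ℓ`, of an element
`σ_ℓ ∈ Γ_ℚ` lying in the tame level `Gal(ℚ̄/ℚ(μ_{ℓ'}))` of every other usable prime `ℓ'`, whose
powers `σ_ℓ^i`, `i < ℓ - 1`, represent `Gal(ℚ̄/ℚ(μ_{n/ℓ})) / Gal(ℚ̄/ℚ(μ_n))`, and such that the
`σ_ℓ`, `ℓ ∣ n`, generate `Γ_ℚ / Gal(ℚ̄/ℚ(μ_n))` (Rubin, *Euler Systems* (2000), §4.4, the choice
of a generator `σ_ℓ` of `G_ℓ = Gal(K(ℓ)/K)`; Mazur–Rubin (2004) App. A).  This file DISCHARGES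
that choice over `ℚ` for the cyclotomic levels `cyclotomicLevelsRat p S`
(`Literature/NumberTheory/GaloisRepresentations/CyclotomicLevels.lean`), from tree inputs only:

* `rootsOfUnityFixer_mul_eq_inf` — `Gal(K̄/K(μ_{AB})) = Gal(K̄/K(μ_A)) ⊓ Gal(K̄/K(μ_B))`, `A ⊥ B`;
* `Rat.exists_sigma` — for a prime `ℓ` there is `σ_ℓ ∈ Γ_ℚ` acting on `μ_ℓ(ℚ̄)` through a
  GENERATOR of `(ℤ/ℓ)ˣ` and fixing every root of unity of order prime to `ℓ` (so
  `σ_ℓ ∈ Gal(ℚ̄/ℚ(μ_{ℓ'}))`, `ℓ' ≠ ℓ`, and `σ_ℓ ∈ Gal(ℚ̄/ℚ(μ_{p^k}))`) — tree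
  `RootOfUnityAction.exists_smul_eq_pow_and_smul_eq_self` (Washington Thm 2.5) +
  `RootOfUnityAction.exists_smul_eq_smul_and_smul_eq_self` (compactness) + `(ℤ/ℓ)ˣ` cyclic;
* `Rat.existsUnique_pow_inv_mul_mem_rootsOfUnityFixer`, `Rat.bijective_quotientMk_pow` — the
  powers `σ_ℓ^i`, `i < ℓ - 1`, are a TRANSVERSAL of `H' / (H' ⊓ Gal(ℚ̄/ℚ(μ_ℓ)))` for every
  subgroup `H' ∋ σ_ℓ`, of size `ℓ - 1` (`Rat.natCard_quotient_subgroupOf_rootsOfUnityFixer`);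
* `Rat.exists_mem_closure_inv_mul_mem_iInf`, `Rat.closure_sup_iInf_rootsOfUnityFixer_eq_top` —
  the `σ_ℓ`, `ℓ ∈ r`, GENERATE `Γ_ℚ` modulo `⨅_{ℓ ∈ r} Gal(ℚ̄/ℚ(μ_ℓ))`; package
  `Rat.exists_sigma_family`;
* `Rat.exists_sigma_cyclotomicLevelsRat` — the same, place-indexed, in the FROZEN binder shapes
  `hσ` / `hcov` / `hinj` of ROW T-DER (n1011-p11, `skel/T-DER.md` v2; cell INBOX 2026-08-21
  19:19Z) for `L = cyclotomicLevelsRat p S` with `N q = ℓ_q - 1`;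
* `exists_frobenius` — the Frobenius choice `hFr` (any number field);
* `Rat.not_subgroupIsUnramifiedAt_of_le_rootsOfUnityFixer`,
  `Rat.not_subgroupIsUnramifiedAt_cyclotomicLevelsRat_level_insert` — the ramification clause
  `hram`: `ℚ(μ_ℓ)` is ramified at an odd prime `ℓ` (tree
  `exists_mem_inertia_modNCyclotomicCharacter_eq`, `χ_ℓ(I_𝔓) = (ℤ/ℓ)ˣ`).

All statements are about `rootsOfUnityFixer`; the level of `cyclotomicLevelsRat p S` at the
bottom `p`-layer is `⨅_{q ∈ r} rootsOfUnityFixer ℚ ℓ_q` (`cyclotomicLevelsRat_level`,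
`rootsOfUnityFixer_one`), see `Rat.cyclotomicLevelsRat_level_zero`.  Theorems only: 0 defs,
0 named facts, 0 sorry.  Ref (context only, nothing cited as an input): Rubin, *Euler Systems*
(2000) §4.4; Washington, *Introduction to Cyclotomic Fields*, Thm 2.5.
-/

noncomputable section

open Field Polynomial
open scoped NumberField

namespace Summit.BirchSwinnertonDyer.Rank1Residual.GaloisImage.CyclotomicLevel

open Literature.NumberTheory.GaloisRepresentations

section AnyField

variable (K : Type*) [Field K]

/-- **Fixers of roots of unity glue over coprime moduli** (any field): `Gal(K̄/K(μ_{AB})) = Gal(K̄/K(μ_A)) ⊓ Gal(K̄/K(μ_B))` for coprime `A, B ≥ 1`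
(`K(μ_A, μ_B) = K(μ_{AB})`). [folklore] -/
theorem rootsOfUnityFixer_mul_eq_inf {A B : ℕ} [NeZero A] [NeZero B] (hAB : A.Coprime B) :
    rootsOfUnityFixer K (A * B) = rootsOfUnityFixer K A ⊓ rootsOfUnityFixer K B := by
  refine le_antisymm (le_inf (rootsOfUnityFixer_le_of_dvd K (dvd_mul_right A B))
    (rootsOfUnityFixer_le_of_dvd K (dvd_mul_left B A))) fun σ hσ t ht ↦ ?_
  exact RootOfUnityAction.smul_eq_self_of_coprime hAB σ hσ.1 hσ.2 t ht

end AnyField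

/-! ## Over `ℚ`: generators, transversals, generation -/

namespace Rat

/-- The bottom `p`-layer of the cyclotomic levels over `ℚ` is the intersection of the tame
fixers: `(cyclotomicLevelsRat p S).level 0 r = ⨅_{q ∈ r} Gal(ℚ̄/ℚ(μ_{ℓ_q}))`. [folklore] -/
theorem cyclotomicLevelsRat_level_zero (p : ℕ) [Fact p.Prime]
    (S : Set (IsDedekindDomain.HeightOneSpectrum (𝓞 ℚ)))
    (r : Finset (IsDedekindDomain.HeightOneSpectrum (𝓞 ℚ))) :
    (cyclotomicLevelsRat p S).level 0 r =
      ⨅ q ∈ r, rootsOfUnityFixer ℚ ((Rat.HeightOneSpectrum.primesEquiv q : Nat.Primes) : ℕ) := by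
  rw [cyclotomicLevelsRat_level, pow_zero, rootsOfUnityFixer_one, top_inf_eq]

/-- **The element `σ_ℓ`.**  For a prime `ℓ` there is `σ ∈ Γ_ℚ` whose image under the mod-`ℓ`
cyclotomic character GENERATES `(ℤ/ℓ)ˣ` (so `σ` acts on `μ_ℓ(ℚ̄)` through a generator of
`Gal(ℚ(μ_ℓ)/ℚ) ≃ (ℤ/ℓ)ˣ`) and which fixes every root of unity of `ℚ̄` of order prime to `ℓ`
(`σ ∈ Gal(ℚ̄/ℚ(μ_m))` for all `m` coprime to `ℓ`).  Rubin, *Euler Systems* §4.4: the generator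
`σ_ℓ` of `G_ℓ`, chosen inside `Gal(K(r)/K(ℓ)) ≃ ∏_{ℓ' ≠ ℓ} G_{ℓ'}`-complement. [folklore] -/
theorem exists_sigma (ℓ : ℕ) (hℓ : ℓ.Prime) :
    haveI : NeZero ℓ := ⟨hℓ.ne_zero⟩
    ∃ σ : absoluteGaloisGroup ℚ,
      (∀ x : (ZMod ℓ)ˣ, x ∈ Subgroup.zpowers (modNCyclotomicCharacter ℚ ℓ σ)) ∧
      ∀ m : ℕ, ℓ.Coprime m → σ ∈ rootsOfUnityFixer ℚ m := by
  haveI : Fact ℓ.Prime := ⟨hℓ⟩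
  haveI : NeZero ℓ := ⟨hℓ.ne_zero⟩
  obtain ⟨g, hg⟩ := IsCyclic.exists_generator (α := (ZMod ℓ)ˣ)
  have hirr : Irreducible (cyclotomic (ℓ * 1) ℚ) := by
    rw [mul_one]
    exact cyclotomic.irreducible_rat hℓ.pos
  obtain ⟨τ, hτ, -⟩ := RootOfUnityAction.exists_smul_eq_pow_and_smul_eq_self (K := ℚ)
    (Nat.coprime_one_right ℓ) hirr g
  obtain ⟨σ, hσℓ, hσm⟩ := RootOfUnityAction.exists_smul_eq_smul_and_smul_eq_self (K := ℚ)
    (fun n hn ↦ cyclotomic.irreducible_rat hn) hℓ τ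
  obtain ⟨ζ, hζ⟩ := HasEnoughRootsOfUnity.exists_primitiveRoot (AlgebraicClosure ℚ) ℓ
  have hχ : modNCyclotomicCharacter ℚ ℓ σ = g := by
    apply Units.ext
    have h1 : σ • ζ = ζ ^ (g : ZMod ℓ).val := by
      rw [hσℓ 1 ζ (by rw [pow_one]; exact hζ.pow_eq_one), hτ ζ hζ.pow_eq_one]
    rw [modNCyclotomicCharacter_eq_of_smul_eq_pow ℚ ℓ hζ σ h1, ZMod.natCast_zmod_val]
  refine ⟨σ, fun x ↦ hχ ▸ hg x, fun m hm ↦ ?_⟩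
  rw [mem_rootsOfUnityFixer_iff]
  exact hσm m hm

variable {ℓ : ℕ} [NeZero ℓ]

/-- If `χ_ℓ(σ)` generates `(ℤ/ℓ)ˣ`, then for every `u ∈ Γ_ℚ` there is a UNIQUE exponent
`i < #(ℤ/ℓ)ˣ` with `σ^{-i} u ∈ Gal(ℚ̄/ℚ(μ_ℓ))`: the powers of `σ` represent `Γ_ℚ / Gal(ℚ̄/ℚ(μ_ℓ))
≃ (ℤ/ℓ)ˣ` exactly once each. [folklore] -/
theorem existsUnique_pow_inv_mul_mem_rootsOfUnityFixer (σ : absoluteGaloisGroup ℚ)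
    (hgen : ∀ x : (ZMod ℓ)ˣ, x ∈ Subgroup.zpowers (modNCyclotomicCharacter ℚ ℓ σ))
    (u : absoluteGaloisGroup ℚ) :
    ∃! i : ℕ, i < Nat.card (ZMod ℓ)ˣ ∧ (σ ^ i)⁻¹ * u ∈ rootsOfUnityFixer ℚ ℓ := by
  set χ := modNCyclotomicCharacter ℚ ℓ with hχdef
  have hord : orderOf (χ σ) = Nat.card (ZMod ℓ)ˣ := orderOf_eq_card_of_forall_mem_zpowers hgen
  have hmem : ∀ i : ℕ, (σ ^ i)⁻¹ * u ∈ rootsOfUnityFixer ℚ ℓ ↔ χ σ ^ i = χ u := by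
    intro i
    rw [rootsOfUnityFixer_eq_ker, MonoidHom.mem_ker, map_mul, map_inv, map_pow,
      inv_mul_eq_one]
  obtain ⟨i, hi, hiu⟩ : ∃ i < orderOf (χ σ), χ σ ^ i = χ u := by
    have h := hgen (χ u)
    rw [← (isOfFinOrder_of_finite (χ σ)).mem_powers_iff_mem_zpowers,
      (isOfFinOrder_of_finite (χ σ)).mem_powers_iff_mem_range_orderOf] at h
    obtain ⟨i, hi, hiu⟩ := Finset.mem_image.mp h
    exact ⟨i, Finset.mem_range.mp hi, hiu⟩
  refine ⟨i, ⟨hord ▸ hi, (hmem i).2 hiu⟩, fun j ⟨hj, hju⟩ ↦ ?_⟩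
  rw [hmem] at hju
  rw [← hord] at hj
  exact pow_injOn_Iio_orderOf (Set.mem_Iio.2 hj) (Set.mem_Iio.2 hi) (hju.trans hiu.symm)

/-- `#(ℤ/ℓ)ˣ = ℓ - 1` for a prime `ℓ` (restated with `Nat.card` for rewriting the exponent
bound). [folklore] -/
theorem natCard_units_zmod_eq_sub_one (hℓ : ℓ.Prime) : Nat.card (ZMod ℓ)ˣ = ℓ - 1 := by
  haveI : Fact ℓ.Prime := ⟨hℓ⟩
  rw [Nat.card_eq_fintype_card, ZMod.card_units ℓ]

/-- **Transversal.**  If `σ ∈ H'` and `χ_ℓ(σ)` generates `(ℤ/ℓ)ˣ`, then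
`i ↦ σ^i · (H' ⊓ Gal(ℚ̄/ℚ(μ_ℓ)))`, `i < #(ℤ/ℓ)ˣ = ℓ - 1`, is a BIJECTION onto the coset space
`H' / (H' ⊓ Gal(ℚ̄/ℚ(μ_ℓ)))` — for `H' = Gal(ℚ̄/ℚ(μ_m))`, `ℓ ∤ m`, this is Rubin's
`Gal(ℚ(μ_{mℓ})/ℚ(μ_m)) = G_ℓ = {σ_ℓ^i}` (*Euler Systems* §4.4). [folklore] -/
theorem bijective_quotientMk_pow (H' : Subgroup (absoluteGaloisGroup ℚ)) (σ : absoluteGaloisGroup ℚ)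
    (hσ : σ ∈ H') (hgen : ∀ x : (ZMod ℓ)ˣ, x ∈ Subgroup.zpowers (modNCyclotomicCharacter ℚ ℓ σ)) :
    Function.Bijective fun i : Fin (Nat.card (ZMod ℓ)ˣ) ↦
      (QuotientGroup.mk (⟨σ, hσ⟩ ^ (i : ℕ)) :
        H' ⧸ (rootsOfUnityFixer ℚ ℓ).subgroupOf H') := by
  constructor
  · intro i j hij
    have h := QuotientGroup.eq.mp hij
    rw [Subgroup.mem_subgroupOf, Subgroup.coe_mul, Subgroup.coe_inv, Subgroup.coe_pow,
      Subgroup.coe_mk] at h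
    -- `(σ^i)⁻¹ σ^j ∈ Fix ℓ` and `(σ^j)⁻¹ σ^j = 1 ∈ Fix ℓ`: uniqueness of the exponent for `u = σ^j`
    have hj : (σ ^ (j : ℕ))⁻¹ * σ ^ (j : ℕ) ∈ rootsOfUnityFixer ℚ ℓ := by
      rw [inv_mul_cancel]; exact one_mem _
    exact Fin.ext ((existsUnique_pow_inv_mul_mem_rootsOfUnityFixer σ hgen (σ ^ (j : ℕ))).unique
      ⟨i.2, h⟩ ⟨j.2, hj⟩)
  · rintro ⟨u⟩
    obtain ⟨i, ⟨hi, hiu⟩, -⟩ := existsUnique_pow_inv_mul_mem_rootsOfUnityFixer σ hgen u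
    refine ⟨⟨i, hi⟩, ?_⟩
    change QuotientGroup.mk _ = QuotientGroup.mk u
    refine QuotientGroup.eq.mpr ?_
    rw [Subgroup.mem_subgroupOf, Subgroup.coe_mul, Subgroup.coe_inv, Subgroup.coe_pow,
      Subgroup.coe_mk]
    exact hiu

/-- **Relative index** `[H' : H' ⊓ Gal(ℚ̄/ℚ(μ_ℓ))] = #(ℤ/ℓ)ˣ = ℓ - 1` whenever `H'` contains a
`σ` with `χ_ℓ(σ)` generating (e.g. `H' = Gal(ℚ̄/ℚ(μ_m))`, `ℓ ∤ m`: `[ℚ(μ_{mℓ}) : ℚ(μ_m)] = ℓ - 1`,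
Rubin's `N_ℓ = #G_ℓ`). [folklore] -/
theorem natCard_quotient_subgroupOf_rootsOfUnityFixer (H' : Subgroup (absoluteGaloisGroup ℚ))
    (σ : absoluteGaloisGroup ℚ) (hσ : σ ∈ H')
    (hgen : ∀ x : (ZMod ℓ)ˣ, x ∈ Subgroup.zpowers (modNCyclotomicCharacter ℚ ℓ σ)) :
    Nat.card (H' ⧸ (rootsOfUnityFixer ℚ ℓ).subgroupOf H') = Nat.card (ZMod ℓ)ˣ := by
  rw [← Nat.card_eq_of_bijective _ (bijective_quotientMk_pow H' σ hσ hgen), Nat.card_fin]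

/-- **Generation.**  Let `r` be a finite set of indices carrying DISTINCT primes `ℓ_i`, and
`σ_i ∈ Γ_ℚ` (`i ∈ r`) such that the powers of `σ_i` represent `Γ_ℚ / Gal(ℚ̄/ℚ(μ_{ℓ_i}))`
(`∀ u, ∃ k, σ_i^{-k} u ∈ Gal(ℚ̄/ℚ(μ_{ℓ_i}))` — e.g. `χ_{ℓ_i}(σ_i)` a generator,
`existsUnique_pow_inv_mul_mem_rootsOfUnityFixer`) and `σ_i` fixes `μ_{ℓ_j}` for `j ≠ i`.  Then
every `τ ∈ Γ_ℚ` is `g · u` with `g` in the subgroup generated by the `σ_i` and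
`u ∈ ⨅_{i ∈ r} Gal(ℚ̄/ℚ(μ_{ℓ_i})) = Gal(ℚ̄/ℚ(μ_{∏ ℓ_i}))` (Rubin, *Euler Systems* §4.4:
`Gal(K(r)/K) ≃ ∏_{ℓ ∣ r} G_ℓ`). [folklore] -/
theorem exists_mem_closure_inv_mul_mem_iInf {ι : Type*} (r : Finset ι) (ℓ : ι → ℕ)
    (σ : ι → absoluteGaloisGroup ℚ)
    (hrep : ∀ i ∈ r, ∀ u : absoluteGaloisGroup ℚ, ∃ k : ℕ, (σ i ^ k)⁻¹ * u ∈ rootsOfUnityFixer ℚ (ℓ i))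
    (hfix : ∀ i ∈ r, ∀ j ∈ r, j ≠ i → σ i ∈ rootsOfUnityFixer ℚ (ℓ j))
    (τ : absoluteGaloisGroup ℚ) :
    ∃ g ∈ Subgroup.closure (σ '' r), g⁻¹ * τ ∈ ⨅ i ∈ r, rootsOfUnityFixer ℚ (ℓ i) := by
  classical
  induction r using Finset.induction_on with
  | empty => exact ⟨1, one_mem _, by simp only [Finset.notMem_empty, not_false_eq_true,
      iInf_neg, iInf_top, Subgroup.mem_top]⟩
  | insert a s ha ih =>
    obtain ⟨g', hg', hg'τ⟩ := ih (fun i hi ↦ hrep i (Finset.mem_insert_of_mem hi))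
      (fun i hi j hj hji ↦ hfix i (Finset.mem_insert_of_mem hi) j (Finset.mem_insert_of_mem hj) hji)
    obtain ⟨k, hk⟩ := hrep a (Finset.mem_insert_self a s) (g'⁻¹ * τ)
    refine ⟨g' * σ a ^ k, ?_, ?_⟩
    · refine mul_mem (Subgroup.closure_mono ?_ hg') (pow_mem (Subgroup.subset_closure ?_) k)
      · exact Set.image_mono (Finset.coe_subset.mpr (Finset.subset_insert a s))
      · exact ⟨a, Finset.mem_coe.mpr (Finset.mem_insert_self a s), rfl⟩
    · rw [mul_inv_rev, mul_assoc, Finset.iInf_insert, Subgroup.mem_inf]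
      refine ⟨hk, ?_⟩
      simp only [Subgroup.mem_iInf] at hg'τ ⊢
      intro i hi
      have hia : i ≠ a := fun h ↦ ha (h ▸ hi)
      exact mul_mem (inv_mem (pow_mem (hfix a (Finset.mem_insert_self a s) i
        (Finset.mem_insert_of_mem hi) hia) k)) (hg'τ i hi)

/-- **Generation, subgroup form**: under the hypotheses of
`exists_mem_closure_inv_mul_mem_iInf`, `⟨σ_i : i ∈ r⟩ ⊔ ⨅_{i ∈ r} Gal(ℚ̄/ℚ(μ_{ℓ_i})) = Γ_ℚ`. [folklore] -/
theorem closure_sup_iInf_rootsOfUnityFixer_eq_top {ι : Type*} (r : Finset ι) (ℓ : ι → ℕ)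
    (σ : ι → absoluteGaloisGroup ℚ)
    (hrep : ∀ i ∈ r, ∀ u : absoluteGaloisGroup ℚ, ∃ k : ℕ, (σ i ^ k)⁻¹ * u ∈ rootsOfUnityFixer ℚ (ℓ i))
    (hfix : ∀ i ∈ r, ∀ j ∈ r, j ≠ i → σ i ∈ rootsOfUnityFixer ℚ (ℓ j)) :
    Subgroup.closure (σ '' r) ⊔ ⨅ i ∈ r, rootsOfUnityFixer ℚ (ℓ i) = ⊤ := by
  refine top_le_iff.mp fun τ _ ↦ ?_
  obtain ⟨g, hg, hgτ⟩ := exists_mem_closure_inv_mul_mem_iInf r ℓ σ hrep hfix τ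
  rw [show τ = g * (g⁻¹ * τ) by rw [mul_inv_cancel_left]]
  exact Subgroup.mul_mem_sup hg hgτ

/-- **The `σ_ℓ`-choice instance, packaged** (Rubin, *Euler Systems* §4.4, over `K = ℚ` with the
levels `ℚ(μ_n)`).  For a finite family of DISTINCT primes `ℓ_i` (`i ∈ r`) there are
`σ_i ∈ Γ_ℚ` with: (1) `χ_{ℓ_i}(σ_i)` generates `(ℤ/ℓ_i)ˣ`; (2) `σ_i` fixes every root of unity
of order prime to `ℓ_i` — in particular `σ_i ∈ Gal(ℚ̄/ℚ(μ_{ℓ_j}))` for `j ≠ i` and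
`σ_i ∈ Gal(ℚ̄/ℚ(μ_{p^k}))` for every prime `p ∉ {ℓ_i}` and every `k`; (3) for every `u ∈ Γ_ℚ` a
unique exponent `e < ℓ_i - 1` with `σ_i^{-e} u ∈ Gal(ℚ̄/ℚ(μ_{ℓ_i}))`; (4) the `σ_i` generate `Γ_ℚ`
modulo `⨅_{i ∈ r} Gal(ℚ̄/ℚ(μ_{ℓ_i}))`. [folklore] -/
theorem exists_sigma_family {ι : Type*} (r : Finset ι) (ℓ : ι → ℕ) (hprime : ∀ i ∈ r, (ℓ i).Prime)
    (hinj : Set.InjOn ℓ r) :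
    ∃ σ : ι → absoluteGaloisGroup ℚ,
      (∀ i (hi : i ∈ r), haveI : NeZero (ℓ i) := ⟨(hprime i hi).ne_zero⟩
        ∀ x : (ZMod (ℓ i))ˣ, x ∈ Subgroup.zpowers (modNCyclotomicCharacter ℚ (ℓ i) (σ i))) ∧
      (∀ i ∈ r, ∀ m : ℕ, (ℓ i).Coprime m → σ i ∈ rootsOfUnityFixer ℚ m) ∧
      (∀ i ∈ r, ∀ j ∈ r, j ≠ i → σ i ∈ rootsOfUnityFixer ℚ (ℓ j)) ∧
      (∀ i ∈ r, ∀ u : absoluteGaloisGroup ℚ,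
        ∃! e : ℕ, e < ℓ i - 1 ∧ (σ i ^ e)⁻¹ * u ∈ rootsOfUnityFixer ℚ (ℓ i)) ∧
      Subgroup.closure (σ '' r) ⊔ ⨅ i ∈ r, rootsOfUnityFixer ℚ (ℓ i) = ⊤ := by
  classical
  choose! σ hσgen hσfix using fun i (hi : i ∈ r) ↦ exists_sigma (ℓ i) (hprime i hi)
  have hfix : ∀ i ∈ r, ∀ j ∈ r, j ≠ i → σ i ∈ rootsOfUnityFixer ℚ (ℓ j) := fun i hi j hj hji ↦
    hσfix i hi (ℓ j) ((Nat.coprime_primes (hprime i hi) (hprime j hj)).mpr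
      fun h ↦ hji (hinj hj hi h.symm))
  have huniq : ∀ i ∈ r, ∀ u : absoluteGaloisGroup ℚ,
      ∃! e : ℕ, e < ℓ i - 1 ∧ (σ i ^ e)⁻¹ * u ∈ rootsOfUnityFixer ℚ (ℓ i) := by
    intro i hi u
    haveI : NeZero (ℓ i) := ⟨(hprime i hi).ne_zero⟩
    rw [← natCard_units_zmod_eq_sub_one (hprime i hi)]
    exact existsUnique_pow_inv_mul_mem_rootsOfUnityFixer (σ i) (hσgen i hi) u
  refine ⟨σ, hσgen, hσfix, hfix, huniq, closure_sup_iInf_rootsOfUnityFixer_eq_top r ℓ σ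
    (fun i hi u ↦ ?_) hfix⟩
  obtain ⟨e, ⟨-, he⟩, -⟩ := huniq i hi u
  exact ⟨e, he⟩

/-! ### The frozen binder shapes of ROW T-DER (n1011-p11, `skel/T-DER.md` v2 + cell INBOX
2026-08-21T19:19Z): `hσ` / `hcov` / `hinj` for the levels `cyclotomicLevelsRat p S`, with
`N q = ℓ_q - 1`; the Frobenius choice `hFr`; the ramification clause `hram`. -/

/-- The tame level of `cyclotomicLevelsRat p S` at the place `q` is `Gal(ℚ̄/ℚ(μ_{ℓ_q}))`
(definitional unfolding, for rewriting). [folklore] -/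
theorem cyclotomicLevelsRat_tameLevel (p : ℕ) [Fact p.Prime]
    (S : Set (IsDedekindDomain.HeightOneSpectrum (𝓞 ℚ)))
    (q : IsDedekindDomain.HeightOneSpectrum (𝓞 ℚ)) :
    (cyclotomicLevelsRat p S).tameLevel q =
      rootsOfUnityFixer ℚ ((Rat.HeightOneSpectrum.primesEquiv q : Nat.Primes) : ℕ) :=
  rfl

/-- **T-DER-INST, place-indexed, in the frozen binder shapes of ROW T-DER** (F3b's `hσ`, `hcov`,
`hinj` with `N q = ℓ_q - 1`, for `L = cyclotomicLevelsRat p S` and ANY finite set `r` of finite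
places of `ℚ`): there are `σ_q ∈ Γ_ℚ` (`q ∈ r`) with (hσ) `σ_ℓ ∈ L.tameLevel q` for
`q ≠ ℓ` in `r`; (hcov) every `g ∈ Γ_ℚ` is `σ_ℓ^j · u` with `j < ℓ - 1`, `u ∈ L.tameLevel ℓ`;
(hinj) the exponent is unique; and moreover `σ_ℓ` fixes every root of unity of order prime to
`ℓ` (so `σ_ℓ ∈ L.pLevel k = Gal(ℚ̄/ℚ(μ_{p^k}))` whenever `ℓ ≠ p`) and `χ_ℓ(σ_ℓ)` generates
`(ℤ/ℓ)ˣ`.  Rubin, *Euler Systems* (2000) §4.4 (choice of `σ_ℓ`), over `K = ℚ`. [folklore] -/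
theorem exists_sigma_cyclotomicLevelsRat (p : ℕ) [Fact p.Prime]
    (S : Set (IsDedekindDomain.HeightOneSpectrum (𝓞 ℚ)))
    (r : Finset (IsDedekindDomain.HeightOneSpectrum (𝓞 ℚ))) :
    ∃ σ : IsDedekindDomain.HeightOneSpectrum (𝓞 ℚ) → absoluteGaloisGroup ℚ,
      (∀ ℓ ∈ r, ∀ q ∈ r, q ≠ ℓ → σ ℓ ∈ (cyclotomicLevelsRat p S).tameLevel q) ∧
      (∀ ℓ ∈ r, ∀ g : absoluteGaloisGroup ℚ,
        ∃ j < ((Rat.HeightOneSpectrum.primesEquiv ℓ : Nat.Primes) : ℕ) - 1,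
          (σ ℓ ^ j)⁻¹ * g ∈ (cyclotomicLevelsRat p S).tameLevel ℓ) ∧
      (∀ ℓ ∈ r, ∀ j₁ < ((Rat.HeightOneSpectrum.primesEquiv ℓ : Nat.Primes) : ℕ) - 1,
        ∀ j₂ < ((Rat.HeightOneSpectrum.primesEquiv ℓ : Nat.Primes) : ℕ) - 1,
          (σ ℓ ^ j₁)⁻¹ * σ ℓ ^ j₂ ∈ (cyclotomicLevelsRat p S).tameLevel ℓ → j₁ = j₂) ∧
      (∀ ℓ ∈ r, ∀ m : ℕ, (((Rat.HeightOneSpectrum.primesEquiv ℓ : Nat.Primes) : ℕ)).Coprime m →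
        σ ℓ ∈ rootsOfUnityFixer ℚ m) ∧
      (∀ ℓ (hℓ : ℓ ∈ r),
        haveI : NeZero ((Rat.HeightOneSpectrum.primesEquiv ℓ : Nat.Primes) : ℕ) :=
          ⟨(Rat.HeightOneSpectrum.primesEquiv ℓ).2.ne_zero⟩
        ∀ x : (ZMod ((Rat.HeightOneSpectrum.primesEquiv ℓ : Nat.Primes) : ℕ))ˣ,
          x ∈ Subgroup.zpowers (modNCyclotomicCharacter ℚ
            ((Rat.HeightOneSpectrum.primesEquiv ℓ : Nat.Primes) : ℕ) (σ ℓ))) := by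
  set ℓn : IsDedekindDomain.HeightOneSpectrum (𝓞 ℚ) → ℕ :=
    fun q ↦ ((Rat.HeightOneSpectrum.primesEquiv q : Nat.Primes) : ℕ) with hℓn
  have hprime : ∀ q ∈ r, (ℓn q).Prime := fun q _ ↦ (Rat.HeightOneSpectrum.primesEquiv q).2
  have hinj : Set.InjOn ℓn r := fun q _ q' _ h ↦
    Rat.HeightOneSpectrum.primesEquiv.injective (Subtype.ext h)
  obtain ⟨σ, hgen, hcop, hfix, huniq, -⟩ := exists_sigma_family r ℓn hprime hinj
  refine ⟨σ, fun ℓ hℓ q hq hqℓ ↦ ?_, fun ℓ hℓ g ↦ ?_, fun ℓ hℓ j₁ hj₁ j₂ hj₂ h ↦ ?_, hcop, hgen⟩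
  · rw [cyclotomicLevelsRat_tameLevel]
    exact hfix ℓ hℓ q hq hqℓ
  · obtain ⟨e, ⟨he, heu⟩, -⟩ := huniq ℓ hℓ g
    exact ⟨e, he, heu⟩
  · rw [cyclotomicLevelsRat_tameLevel] at h
    have h₂ : (σ ℓ ^ j₂)⁻¹ * σ ℓ ^ j₂ ∈ rootsOfUnityFixer ℚ (ℓn ℓ) := by
      rw [inv_mul_cancel]
      exact one_mem _
    exact (huniq ℓ hℓ (σ ℓ ^ j₂)).unique ⟨hj₁, h⟩ ⟨hj₂, h₂⟩

/-- **The Frobenius choice `hFr`** (any number field): there is a function `Fr` assigning to every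
finite place `v` an arithmetic Frobenius `Fr v ∈ Γ_K` at `v` (tree
`exists_isArithFrobAt_of_mem_primesAbove_holds`, `primesAbove_nonempty`).  Rubin, *Euler Systems*
(2000), Ch. II §1 ("let `Fr_q` denote a Frobenius of `q` in `G_K`"). [folklore] -/
theorem _root_.Summit.BirchSwinnertonDyer.Rank1Residual.GaloisImage.CyclotomicLevel.exists_frobenius
    (K : Type) [Field K] [NumberField K] :
    ∃ Fr : IsDedekindDomain.HeightOneSpectrum (𝓞 K) → absoluteGaloisGroup K,
      ∀ v, IsArithFrobAtPlace K v (Fr v) := by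
  have h : ∀ v : IsDedekindDomain.HeightOneSpectrum (𝓞 K), ∃ σ, IsArithFrobAtPlace K v σ := by
    intro v
    obtain ⟨𝔓, h𝔓⟩ := v.primesAbove_nonempty
    obtain ⟨σ, hσ⟩ :=
      IsDedekindDomain.HeightOneSpectrum.exists_isArithFrobAt_of_mem_primesAbove_holds h𝔓
    exact ⟨σ, 𝔓, h𝔓, hσ⟩
  choose Fr hFr using h
  exact ⟨Fr, hFr⟩

/-- **`ℚ(μ_ℓ)/ℚ` is ramified at `ℓ` (`ℓ` an odd prime), in the currency of `SubgroupIsUnramifiedAt`:**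
no subgroup `U ≤ Gal(ℚ̄/ℚ(μ_ℓ))` is unramified at the place `v = ℓ` — the absolute inertia group
at a prime of `ℤ̄` above `ℓ` contains an element with `χ_ℓ = -1 ≠ 1` (tree
`exists_mem_inertia_modNCyclotomicCharacter_eq`: `χ_ℓ(I_𝔓) = (ℤ/ℓ)ˣ`, Neukirch I (10.3)–(10.4),
Serre LF I §7 Prop. 22 (b)), which `U` would have to contain.  For `ℓ = 2` the statement is
false (`ℚ(μ_2) = ℚ`), whence `h2`. [folklore] -/
theorem not_subgroupIsUnramifiedAt_of_le_rootsOfUnityFixer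
    {v : IsDedekindDomain.HeightOneSpectrum (𝓞 ℚ)}
    (h2 : ((Rat.HeightOneSpectrum.primesEquiv v : Nat.Primes) : ℕ) ≠ 2)
    {U : Subgroup (absoluteGaloisGroup ℚ)}
    (hU : U ≤ rootsOfUnityFixer ℚ ((Rat.HeightOneSpectrum.primesEquiv v : Nat.Primes) : ℕ)) :
    ¬ SubgroupIsUnramifiedAt ℚ U v := by
  set ℓ : ℕ := ((Rat.HeightOneSpectrum.primesEquiv v : Nat.Primes) : ℕ) with hℓdef
  have hℓ : ℓ.Prime := (Rat.HeightOneSpectrum.primesEquiv v).2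
  haveI : Fact ℓ.Prime := ⟨hℓ⟩
  intro hun
  obtain ⟨𝔓, h𝔓⟩ := v.primesAbove_nonempty
  -- `-1 ≠ 1` in `(ℤ/ℓ)ˣ` for `ℓ ≠ 2`
  haveI : Fact (2 < ℓ) := ⟨lt_of_le_of_ne hℓ.two_le (Ne.symm h2)⟩
  have hne : (-1 : (ZMod ℓ)ˣ) ≠ 1 := by
    intro h
    have h' : ((-1 : (ZMod ℓ)ˣ) : ZMod ℓ) = ((1 : (ZMod ℓ)ˣ) : ZMod ℓ) := by rw [h]
    rw [Units.val_neg, Units.val_one] at h'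
    exact ZMod.neg_one_ne_one h'
  -- an absolute inertia element with `χ_ℓ = -1`
  have hm : ℓ = ℓ ^ (0 + 1) * 1 := by rw [zero_add, pow_one, mul_one]
  have hd : ¬ ℓ ∣ 1 := hℓ.not_dvd_one
  have ha : ZMod.unitsMap (Dvd.intro_left _ hm.symm) (-1 : (ZMod ℓ)ˣ) = 1 := Subsingleton.elim _ _
  obtain ⟨τ, hτI, hτχ⟩ := exists_mem_inertia_modNCyclotomicCharacter_eq (v := v) hm hd rfl h𝔓 ha
  have hτU : τ ∈ rootsOfUnityFixer ℚ ℓ := hU (hun 𝔓 h𝔓 hτI)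
  rw [rootsOfUnityFixer_eq_ker, MonoidHom.mem_ker, hτχ] at hτU
  exact hne hτU

/-- **The ramification clause `hram` of ROW T-DER for `cyclotomicLevelsRat p S`**: for a place
`ℓ ≠ 2` and any `s`, `i`, the level `Gal(ℚ̄/ℚ(μ_{p^i}, μ_ℓ, μ_s))` is NOT unramified at `ℓ`
(so `IsEulerSystem.cores_cons`, the Euler-factor relation, is the tame step that applies). [folklore] -/
theorem not_subgroupIsUnramifiedAt_cyclotomicLevelsRat_level_insert (p : ℕ) [Fact p.Prime]
    (S : Set (IsDedekindDomain.HeightOneSpectrum (𝓞 ℚ))) (i : ℕ)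
    {ℓ : IsDedekindDomain.HeightOneSpectrum (𝓞 ℚ)}
    (h2 : ((Rat.HeightOneSpectrum.primesEquiv ℓ : Nat.Primes) : ℕ) ≠ 2)
    [DecidableEq (IsDedekindDomain.HeightOneSpectrum (𝓞 ℚ))]
    (s : Finset (IsDedekindDomain.HeightOneSpectrum (𝓞 ℚ))) :
    ¬ SubgroupIsUnramifiedAt ℚ ((cyclotomicLevelsRat p S).level i (insert ℓ s)) ℓ := by
  refine not_subgroupIsUnramifiedAt_of_le_rootsOfUnityFixer h2 fun τ hτ ↦ ?_
  rw [EulerSystemLevels.mem_level_iff] at hτ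
  have h := hτ.2 ℓ (Finset.mem_insert_self ℓ s)
  rwa [cyclotomicLevelsRat_tameLevel] at h


end Rat

end Summit.BirchSwinnertonDyer.Rank1Residual.GaloisImage.CyclotomicLevel

end
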